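import Literature.NumberTheory.GaloisRepresentations.NormalBasisCongruence
import Literature.NumberTheory.GaloisRepresentations.HeckeCharacterWeakApproximation
import Literature.NumberTheory.Automorphic.ClassFieldCharacter
import Literature.NumberTheory.Automorphic.AdicCompletionCompact
import Mathlib.FieldTheory.Galois.NormalBasis
import Mathlib.RingTheory.Trace.Basic
import Mathlib.LinearAlgebra.Matrix.Nondegenerate
import Mathlib.Topology.Algebra.Module.FiniteDimension
import HarnessLib

/-!
# The semi-local algebra `∏_{w ∣ v} E_w` of a Galois extension at a finite place and the Herbrand
# quotient of its units

Topic `NumberTheory/GaloisRepresentations` (class field theory: the local factors of the idelic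
Herbrand quotient in the *global cyclic norm index inequality*, Childress, *Class Field Theory*,
Ch. 4, Lemma 5.3 and Prop. 5.7 (i): "if `w` is finite, `Q_{G_w}(𝒰_w) = 1`", and, through
Shapiro's lemma (Prop. 4.5), `Q_G(∏_{w ∣ v} 𝒰_w) = 1`); namespace
`Literature.NumberTheory.GaloisRepresentations.SemiLocal`.  Definitions with their API; every
statement is **proved**.

## What is here

For a finite Galois extension of number fields `E/F` with group `G = Gal(E/F)` and a finite place
`v` of `F`:

* `SemiLocal.Place F E v` — the (finitely many, `Fintype`) places `w` of `E` above `v`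
  (`w.under (𝓞 F) = v`), with the action of `G` (`σ • w`, Cassels–Fröhlich VII §1.1);
* `SemiLocal F E v = ∏_{w ∣ v} E_w` — the semi-local algebra, a commutative `F_v`-algebra
  (through the local base-change maps `F_v → E_w` of `AdeleBaseChange.lean`) on which `G` acts by
  `F_v`-linear continuous ring automorphisms: `(σ • x)_w = σ_{σ⁻¹w}(x_{σ⁻¹ w})`
  (`galAdicCompletionMap` of `GaloisActionPlaces.lean`); the diagonal embedding
  `SemiLocal.diag : E →+* ∏_{w ∣ v} E_w` is `G`-equivariant and has dense range (weak
  approximation);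
* `SemiLocal.basis` — **the normal basis of `E/F` is an `F_v`-basis of `∏_{w ∣ v} E_w`**
  (i.e. `E ⊗_F F_v ≅ ∏_{w ∣ v} E_w`, Cassels–Fröhlich II §10): linear independence by the
  non-degeneracy of the trace form (`det_traceForm_ne_zero`) transported through the
  `G`-equivariance of `diag`, spanning because the span is closed (finite-dimensional over the
  complete field `F_v`) and contains the dense image of `E`;
* `SemiLocal.unitGroup F E v = ∏_{w ∣ v} 𝒪_wˣ ≤ (∏ E_w)ˣ`, a `G`-stable subgroup, and
  **`h0_unitGroup_eq_h1`: `#Ĥ⁰(G, ∏_{w∣v} 𝒪_wˣ) = #Ĥ⁻¹(G, ∏_{w∣v} 𝒪_wˣ) ≠ 0`** for cyclic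
  `G = ⟨σ⟩` (Childress Prop. 5.7 (i) with Prop. 4.5, in the index language of
  `CyclicHerbrandQuotient.lean`): the scaled normal basis has small structure constants, its
  congruence subgroup `V` (`NormalBasisCongruence.lean`) lies in `∏ 𝒪_wˣ`, is cohomologically
  trivial, and has finite index (it is open and `∏ 𝒪_wˣ` is compact), so Childress's Cor. 4.4
  applies;
* `exists_norm_eq_algebraMap_of_norm_sub_one_le` — the norm group `N_G(∏ 𝒪_wˣ)` contains
  (the image of) a neighbourhood `1 + 𝔭_v^k` of `1` in `F_vˣ` (used for the admissible modulus).

## References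

* N. Childress, *Class Field Theory*, Universitext, Springer 2009, Ch. 4 §4 Prop. 4.5, §5
  Lemma 5.3, Prop. 5.7 (i) (PDF pp. 86–87, 92–94, 98). [Childress2009]
* J. W. S. Cassels, A. Fröhlich (eds.), *Algebraic Number Theory* (1967), Ch. II (Cassels)
  §10 (`L ⊗_K K_v ≅ ∏ L_w`), Ch. VII (Tate) §1.1. [CasselsFrohlichANT1967]
* J. Neukirch, *Algebraic Number Theory*, Springer 1999, Ch. V §1 Thm. (1.1) (proof).
  [NeukirchANT1999]
-/

noncomputable section

open NumberField IsDedekindDomain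
open scoped Valued

namespace Literature.NumberTheory.GaloisRepresentations

namespace SemiLocal

open Literature.NumberTheory.Automorphic

universe u

variable (F : Type u) [Field F] [NumberField F] (E : Type u) [Field E] [NumberField E] [Algebra F E]
variable (v : HeightOneSpectrum (𝓞 F))

/-! ### The places of `E` above `v` -/

/-- The finite places `w` of `E` above the finite place `v` of `F` (`w ∩ 𝓞 F = v`). [folklore] -/
def Place : Type u := {w : HeightOneSpectrum (𝓞 E) // w.under (𝓞 F) = v}

variable {F E v}

namespace Place

/-- The underlying place of `E`. [folklore] -/
@[coe] def val (w : Place F E v) : HeightOneSpectrum (𝓞 E) := Subtype.val w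

/-- Places above `v` coerce to places of `E`. [folklore] -/
instance : CoeOut (Place F E v) (HeightOneSpectrum (𝓞 E)) := ⟨val⟩

omit [NumberField F] [NumberField E] in
/-- Extensionality for places above `v`. [folklore] -/
@[ext] theorem ext {w w' : Place F E v} (h : (w : HeightOneSpectrum (𝓞 E)) = w') : w = w' :=
  Subtype.ext h

omit [NumberField F] [NumberField E] in
/-- The defining property `w ∩ 𝓞 F = v`. [folklore] -/
theorem under_eq (w : Place F E v) : (w : HeightOneSpectrum (𝓞 E)).under (𝓞 F) = v := w.2

/-- `𝔭_w` lies over `𝔭_v`. [folklore] -/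
instance liesOver (w : Place F E v) : (w : HeightOneSpectrum (𝓞 E)).asIdeal.LiesOver v.asIdeal :=
  ⟨(congrArg HeightOneSpectrum.asIdeal w.under_eq).symm⟩

/-- There are finitely many places above `v`. [folklore] -/
instance finite : Finite (Place F E v) := by
  refine Finite.of_injective (fun w : Place F E v =>
    (⟨(w : HeightOneSpectrum (𝓞 E)).asIdeal, (w : HeightOneSpectrum (𝓞 E)).isPrime,
      Place.liesOver w⟩ : v.asIdeal.primesOver (𝓞 E))) fun w w' h => ?_
  exact Place.ext (HeightOneSpectrum.ext (congrArg Subtype.val h))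

/-- The places above `v` form a finite type. [folklore] -/
instance fintype : Fintype (Place F E v) := Fintype.ofFinite _

/-- There is a place above `v`. [folklore] -/
instance nonempty : Nonempty (Place F E v) := by
  obtain ⟨P, hPm, hP⟩ := Ideal.exists_maximal_ideal_liesOver_of_isIntegral (S := 𝓞 E) v.asIdeal
  refine ⟨⟨⟨P, hPm.isPrime, ?_⟩, HeightOneSpectrum.ext hP.over.symm⟩⟩
  exact Ideal.ne_bot_of_liesOver_of_ne_bot v.ne_bot P

/-- `Gal(E/F)` permutes the places above `v`. [cite: CasselsFrohlichANT1967, Ch. VII §1.1] -/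
instance mulAction : MulAction (E ≃ₐ[F] E) (Place F E v) where
  smul σ w := ⟨σ • (w : HeightOneSpectrum (𝓞 E)), by
    rw [HeightOneSpectrum.under_algEquiv_smul F E σ]; exact w.under_eq⟩
  one_smul w := Place.ext (one_smul _ (w : HeightOneSpectrum (𝓞 E)))
  mul_smul σ τ w := Place.ext (mul_smul σ τ (w : HeightOneSpectrum (𝓞 E)))

/-- `↑(σ • w) = σ • ↑w` (definitional). [folklore] -/
@[simp] theorem coe_smul (σ : E ≃ₐ[F] E) (w : Place F E v) :
    ((σ • w : Place F E v) : HeightOneSpectrum (𝓞 E)) = σ • (w : HeightOneSpectrum (𝓞 E)) := rfl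

/-- `σ • ↑(σ⁻¹ • w) = ↑w` (the transport datum used for the action on `∏ E_w`). [folklore] -/
theorem smul_coe_inv_smul (σ : E ≃ₐ[F] E) (w : Place F E v) :
    σ • ((σ⁻¹ • w : Place F E v) : HeightOneSpectrum (𝓞 E)) = w :=
  congrArg Place.val (smul_inv_smul σ w)

/-- `σ • ↑w = ↑(σ • w)`. [folklore] -/
theorem smul_coe (σ : E ≃ₐ[F] E) (w : Place F E v) :
    σ • (w : HeightOneSpectrum (𝓞 E)) = ((σ • w : Place F E v) : HeightOneSpectrum (𝓞 E)) := rfl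

variable [IsGalois F E] in
/-- `Gal(E/F)` is transitive on the places above `v`. [cite: CasselsFrohlichANT1967, Ch. VII Prop. 1.2 (ii)] -/
theorem exists_smul_eq (w w' : Place F E v) : ∃ σ : E ≃ₐ[F] E, σ • w = w' := by
  obtain ⟨σ, hσ⟩ := HeightOneSpectrum.exists_algEquiv_smul_eq F (w := (w : HeightOneSpectrum (𝓞 E)))
    (w' := (w' : HeightOneSpectrum (𝓞 E))) (by rw [w.under_eq, w'.under_eq])
  exact ⟨σ, Place.ext hσ⟩

end Place

variable (F E v)

/-! ### The semi-local algebra `∏_{w ∣ v} E_w` -/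

/-- The semi-local algebra `∏_{w ∣ v} E_w` of `E/F` at `v` (Cassels–Fröhlich II §10:
`L ⊗_K K_v ≅ ∏ L_w`). [cite: CasselsFrohlichANT1967, Ch. II §10] -/
abbrev _root_.Literature.NumberTheory.GaloisRepresentations.SemiLocal : Type u :=
  ∀ w : Place F E v, (w : HeightOneSpectrum (𝓞 E)).adicCompletion E

variable {F E v}

/-- `E_w` is an `F_v`-algebra through the local base-change map `F_v → E_w` (`w ∣ v`). [folklore] -/
instance algebraPlace (w : Place F E v) :
    Algebra (v.adicCompletion F) ((w : HeightOneSpectrum (𝓞 E)).adicCompletion E) :=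
  (adicCompletionOfLiesOver F E v (w : HeightOneSpectrum (𝓞 E))).toAlgebra

/-- The structure map `F_v → E_w` is `adicCompletionOfLiesOver`. [folklore] -/
theorem algebraMap_place_eq (w : Place F E v) :
    algebraMap (v.adicCompletion F) ((w : HeightOneSpectrum (𝓞 E)).adicCompletion E) =
      adicCompletionOfLiesOver F E v (w : HeightOneSpectrum (𝓞 E)) := rfl

/-- Components of the structure map `F_v → ∏ E_w`. [folklore] -/
theorem algebraMap_apply (c : v.adicCompletion F) (w : Place F E v) :
    algebraMap (v.adicCompletion F) (SemiLocal F E v) c w =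
      adicCompletionOfLiesOver F E v (w : HeightOneSpectrum (𝓞 E)) c := rfl

/-- The structure map `F_v → ∏_{w ∣ v} E_w` is continuous. [folklore] -/
theorem continuous_algebraMap :
    Continuous (algebraMap (v.adicCompletion F) (SemiLocal F E v)) :=
  continuous_pi fun w => continuous_adicCompletionOfLiesOver F E v (w : HeightOneSpectrum (𝓞 E))

/-- Scalar multiplication by `F_v` on `∏ E_w` is continuous. [folklore] -/
instance continuousSMul : ContinuousSMul (v.adicCompletion F) (SemiLocal F E v) :=
  continuousSMul_of_algebraMap _ _ continuous_algebraMap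

/-! ### The action of `Gal(E/F)` -/

omit [NumberField F] in
/-- Transport along an equality of places above `v`, for a dependent family. [folklore] -/
theorem galAdicCompletionMap_congr_place {σ : E ≃ₐ[F] E} {w₁ w₂ w : Place F E v} (hw : w₁ = w₂)
    (h₁ : σ • (w₁ : HeightOneSpectrum (𝓞 E)) = w) (h₂ : σ • (w₂ : HeightOneSpectrum (𝓞 E)) = w)
    (x : SemiLocal F E v) :
    galAdicCompletionMap σ h₁ (x w₁) = galAdicCompletionMap σ h₂ (x w₂) := by
  subst hw; rfl

variable (F E v) in
/-- The action of `σ ∈ Gal(E/F)` on `∏_{w ∣ v} E_w`: `(σ x)_w = σ (x_{σ⁻¹ w})`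
(Cassels–Fröhlich VII §1.1). [cite: CasselsFrohlichANT1967, Ch. VII §1.1] -/
def galMap (σ : E ≃ₐ[F] E) : SemiLocal F E v →+* SemiLocal F E v :=
  RingHom.pi fun w : Place F E v =>
    (galAdicCompletionMap (L := E) σ (Place.smul_coe_inv_smul σ w)).comp (Pi.evalRingHom _ (σ⁻¹ • w))

/-- Components of `galMap σ x`. [folklore] -/
@[simp] theorem galMap_apply (σ : E ≃ₐ[F] E) (x : SemiLocal F E v) (w : Place F E v) :
    galMap F E v σ x w = galAdicCompletionMap σ (Place.smul_coe_inv_smul σ w) (x (σ⁻¹ • w)) := rfl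

/-- The identity acts trivially. [folklore] -/
theorem galMap_one (x : SemiLocal F E v) : galMap F E v 1 x = x := by
  funext w
  rw [galMap_apply, galAdicCompletionMap_congr_place (show (1 : E ≃ₐ[F] E)⁻¹ • w = w by simp) _
    (one_smul _ (w : HeightOneSpectrum (𝓞 E))) x, galAdicCompletionMap_one]

/-- Cocycle law `galMap σ (galMap τ x) = galMap (σ τ) x`. [folklore] -/
theorem galMap_galMap (σ τ : E ≃ₐ[F] E) (x : SemiLocal F E v) :
    galMap F E v σ (galMap F E v τ x) = galMap F E v (σ * τ) x := by
  funext w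
  have hw : (τ⁻¹ • σ⁻¹ • w : Place F E v) = (σ * τ)⁻¹ • w := by rw [mul_inv_rev, mul_smul]
  rw [galMap_apply, galMap_apply, galMap_apply, galAdicCompletionMap_galAdicCompletionMap]
  exact galAdicCompletionMap_congr_place hw _ _ x

/-- **`Gal(E/F)` acts on `∏_{w ∣ v} E_w` by ring automorphisms.** A new instance.
[cite: CasselsFrohlichANT1967, Ch. VII §1.1] -/
instance mulSemiringAction : MulSemiringAction (E ≃ₐ[F] E) (SemiLocal F E v) where
  smul σ x := galMap F E v σ x
  one_smul x := galMap_one x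
  mul_smul σ τ x := (galMap_galMap σ τ x).symm
  smul_zero σ := map_zero (galMap F E v σ)
  smul_add σ x y := map_add (galMap F E v σ) x y
  smul_one σ := map_one (galMap F E v σ)
  smul_mul σ x y := map_mul (galMap F E v σ) x y

/-- Components of `σ • x`: `(σ • x)_w = σ (x_{σ⁻¹ w})`. [folklore] -/
theorem smul_apply (σ : E ≃ₐ[F] E) (x : SemiLocal F E v) (w : Place F E v) :
    (σ • x) w = galAdicCompletionMap σ (Place.smul_coe_inv_smul σ w) (x (σ⁻¹ • w)) :=
  rfl

/-- Components of `σ • x` at `σ • w`: `(σ • x)_{σ w} = σ (x_w)`. [folklore] -/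
theorem smul_apply_smul (σ : E ≃ₐ[F] E) (x : SemiLocal F E v) (w : Place F E v) :
    (σ • x) (σ • w) = galAdicCompletionMap σ (Place.smul_coe σ w) (x w) := by
  rw [smul_apply]
  exact galAdicCompletionMap_congr_place (inv_smul_smul σ w) _ _ x

/-- The action is `F_v`-linear. [cite: CasselsFrohlichANT1967, Ch. VII §1.1] -/
instance smulCommClass : SMulCommClass (E ≃ₐ[F] E) (v.adicCompletion F) (SemiLocal F E v) where
  smul_comm σ c x := by
    funext w
    show galAdicCompletionMap σ (Place.smul_coe_inv_smul σ w) (c • x (σ⁻¹ • w)) = c • (σ • x) w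
    rw [Algebra.smul_def, Algebra.smul_def, map_mul]
    congr 1
    exact galAdicCompletionMap_adicCompletionOfLiesOver F σ v (Place.smul_coe_inv_smul σ w) c

/-- Each `σ` acts continuously. [folklore] -/
theorem continuous_smul (σ : E ≃ₐ[F] E) : Continuous fun x : SemiLocal F E v => σ • x :=
  continuous_pi fun w => (continuous_galAdicCompletionMap E σ
    (Place.smul_coe_inv_smul σ w)).comp (continuous_apply (σ⁻¹ • w))

/-! ### The diagonal embedding of `E` -/

variable (F E v) in
/-- The diagonal embedding `E → ∏_{w ∣ v} E_w`. [folklore] -/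
def diag : E →+* SemiLocal F E v :=
  RingHom.pi fun w : Place F E v => algebraMap E ((w : HeightOneSpectrum (𝓞 E)).adicCompletion E)

omit [NumberField F] in
/-- Components of the diagonal embedding. [folklore] -/
@[simp] theorem diag_apply (x : E) (w : Place F E v) :
    diag F E v x w = (x : (w : HeightOneSpectrum (𝓞 E)).adicCompletion E) := rfl

/-- **The diagonal embedding is `Gal(E/F)`-equivariant**: `σ • diag x = diag (σ x)`. [folklore] -/
@[simp] theorem smul_diag (σ : E ≃ₐ[F] E) (x : E) : σ • diag F E v x = diag F E v (σ x) := by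
  funext w
  show galAdicCompletionMap σ (Place.smul_coe_inv_smul σ w)
      ((x : E) : ((σ⁻¹ • w : Place F E v) : HeightOneSpectrum (𝓞 E)).adicCompletion E) =
    ((σ x : E) : (w : HeightOneSpectrum (𝓞 E)).adicCompletion E)
  exact galAdicCompletionMap_coe_algEquiv F σ (Place.smul_coe_inv_smul σ w) x

/-- On `F` the diagonal embedding is the structure map: `diag (a) = (a)_{F_v}`. [folklore] -/
theorem diag_algebraMap (a : F) :
    diag F E v (algebraMap F E a) = algebraMap (v.adicCompletion F) (SemiLocal F E v) (a : v.adicCompletion F) := by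
  funext w
  rw [diag_apply, algebraMap_apply, adicCompletionOfLiesOver_coe]

/-- `diag (a • x) = a • diag x` for `a ∈ F`. [folklore] -/
theorem diag_smul (a : F) (x : E) :
    diag F E v (a • x) = (a : v.adicCompletion F) • diag F E v x := by
  rw [Algebra.smul_def, map_mul, diag_algebraMap, ← Algebra.smul_def]

/-- **Weak approximation**: `E` is dense in `∏_{w ∣ v} E_w`. [cite: CasselsFrohlichANT1967, Ch. II §6 Lemma] -/
theorem denseRange_diag : DenseRange (diag F E v) := by
  classical
  let S : Finset (HeightOneSpectrum (𝓞 E)) := Finset.univ.image fun w : Place F E v => (w : HeightOneSpectrum (𝓞 E))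
  have hmem : ∀ w : Place F E v, (w : HeightOneSpectrum (𝓞 E)) ∈ S := fun w =>
    Finset.mem_image.mpr ⟨w, Finset.mem_univ _, rfl⟩
  let g : ((∀ u : S, u.1.adicCompletion E) × InfiniteAdeleRing E) → SemiLocal F E v :=
    fun p w => p.1 ⟨w, hmem w⟩
  have hg : Continuous g := continuous_pi fun w => (continuous_apply _).comp continuous_fst
  have hgs : Function.Surjective g := by
    intro y
    refine ⟨(fun u => if h : ∃ w : Place F E v, (w : HeightOneSpectrum (𝓞 E)) = u.1 then
      cast (by rw [h.choose_spec]) (y h.choose) else 0, 1), ?_⟩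
    funext w
    have h : ∃ w' : Place F E v, (w' : HeightOneSpectrum (𝓞 E)) = w := ⟨w, rfl⟩
    have hw : h.choose = w := Place.ext h.choose_spec
    simp only [g, dif_pos h]
    -- transport along `h.choose = w`
    have : ∀ (w' : Place F E v) (e : w' = w) (e' : ((w' : HeightOneSpectrum (𝓞 E)).adicCompletion E) =
        ((w : HeightOneSpectrum (𝓞 E)).adicCompletion E)), cast e' (y w') = y w := by
      rintro w' rfl e'; rfl
    exact this _ hw _
  have hd := denseRange_algebraMap_pi_prod (K := E) S
  have : diag F E v = g ∘ fun k : E =>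
      ((fun u : S => algebraMap E (u.1.adicCompletion E) k), algebraMap E (InfiniteAdeleRing E) k) := by
    funext k; rfl
  rw [this]
  exact hgs.denseRange.comp hd hg

/-! ### The normal basis of `E/F` is an `F_v`-basis of `∏_{w ∣ v} E_w` -/

section Basis

variable [IsGalois F E]

/-- **The trace operator through the diagonal embedding**:
`∑_σ σ • diag y = (Tr_{E/F} y)_{F_v}`. [folklore] -/
theorem sum_smul_diag (y : E) :
    ∑ σ : E ≃ₐ[F] E, σ • diag F E v y =
      algebraMap (v.adicCompletion F) (SemiLocal F E v) (Algebra.trace F E y : v.adicCompletion F) := by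
  simp_rw [smul_diag]
  rw [← map_sum (diag F E v), ← trace_eq_sum_automorphisms, diag_algebraMap]

/-- **The normal basis vectors `diag (g α)` are linearly independent over `F_v`** (if
`∑ c_g · diag(gα) = 0`, multiply by `diag(hα)` and apply `∑_σ σ`: the vector `c` is killed by the
image of the trace matrix of the basis `{gα}`, whose determinant is a non-zero element of `F`).
[cite: CasselsFrohlichANT1967, Ch. II §10] -/
theorem linearIndependent_diag_normalBasis :
    LinearIndependent (v.adicCompletion F)
      (fun g : E ≃ₐ[F] E => diag F E v (IsGalois.normalBasis F E g)) := by
  classical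
  set nb := IsGalois.normalBasis F E with hnb
  rw [Fintype.linearIndependent_iff]
  intro c hc
  -- the trace matrix and its image in `F_v`
  set T : Matrix (E ≃ₐ[F] E) (E ≃ₐ[F] E) F := Algebra.traceMatrix F nb with hT
  have hdet : T.det ≠ 0 := by
    rw [hT, Algebra.traceMatrix_of_basis]; exact det_traceForm_ne_zero nb
  set T' : Matrix (E ≃ₐ[F] E) (E ≃ₐ[F] E) (v.adicCompletion F) :=
    (algebraMap F (v.adicCompletion F)).mapMatrix T with hT'
  have hdet' : T'.det ≠ 0 := by
    rw [hT', ← RingHom.map_det]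
    exact (map_ne_zero _).mpr hdet
  have hTapply : ∀ g h, T' g h = ((Algebra.trace F E (nb g * nb h) : F) : v.adicCompletion F) := by
    intro g h
    rw [hT', RingHom.mapMatrix_apply, Matrix.map_apply, hT, Algebra.traceMatrix_apply,
      Algebra.traceForm_apply]
    rfl
  -- `c ᵥ* T' = 0`
  have hvec : Matrix.vecMul c T' = 0 := by
    funext h
    have key : algebraMap (v.adicCompletion F) (SemiLocal F E v) (∑ g, c g * T' g h) = 0 := by
      have e1 : (∑ g, c g • diag F E v (nb g)) * diag F E v (nb h) =
          ∑ g, c g • diag F E v (nb g * nb h) := by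
        rw [Finset.sum_mul]
        exact Finset.sum_congr rfl fun g _ => by rw [smul_mul_assoc, map_mul]
      calc algebraMap (v.adicCompletion F) (SemiLocal F E v) (∑ g, c g * T' g h)
          = ∑ g, c g • ∑ σ : E ≃ₐ[F] E, σ • diag F E v (nb g * nb h) := by
            rw [map_sum]
            exact Finset.sum_congr rfl fun g _ => by
              rw [map_mul, hTapply, ← sum_smul_diag, ← Algebra.smul_def]
        _ = ∑ σ : E ≃ₐ[F] E, σ • ∑ g, c g • diag F E v (nb g * nb h) := by
            simp_rw [Finset.smul_sum]
            rw [Finset.sum_comm]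
            refine Finset.sum_congr rfl fun σ _ => Finset.sum_congr rfl fun g _ => ?_
            exact (smul_comm σ (c g) _).symm
        _ = ∑ σ : E ≃ₐ[F] E, σ • ((∑ g, c g • diag F E v (nb g)) * diag F E v (nb h)) := by
            simp_rw [e1]
        _ = 0 := by rw [hc, zero_mul]; simp
    have hinj := (algebraMap (v.adicCompletion F) (SemiLocal F E v)).injective
    have : ∑ g, c g * T' g h = 0 := hinj (by rw [key, map_zero])
    simpa [Matrix.vecMul, dotProduct] using this
  exact fun g => congrFun (Matrix.eq_zero_of_vecMul_eq_zero hdet' hvec) g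

/-- **The normal basis vectors span `∏_{w ∣ v} E_w` over `F_v`**: the span is closed
(finite-dimensional over the complete field `F_v`) and contains the dense image of `E`.
[cite: CasselsFrohlichANT1967, Ch. II §10] -/
theorem span_diag_normalBasis_eq_top :
    Submodule.span (v.adicCompletion F)
      (Set.range fun g : E ≃ₐ[F] E => diag F E v (IsGalois.normalBasis F E g)) = ⊤ := by
  letI : NontriviallyNormedField (v.adicCompletion F) :=
    Valued.toNontriviallyNormedField (v.adicCompletion F) (WithZero (Multiplicative ℤ))
  set W := Submodule.span (v.adicCompletion F)
    (Set.range fun g : E ≃ₐ[F] E => diag F E v (IsGalois.normalBasis F E g)) with hW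
  haveI : FiniteDimensional (v.adicCompletion F) W :=
    FiniteDimensional.span_of_finite _ (Set.finite_range _)
  have hclosed : IsClosed (W : Set (SemiLocal F E v)) := W.closed_of_finiteDimensional
  have hsub : Set.range (diag F E v) ⊆ W := by
    rintro _ ⟨x, rfl⟩
    have hx : x = ∑ g, (IsGalois.normalBasis F E).repr x g • IsGalois.normalBasis F E g :=
      ((IsGalois.normalBasis F E).sum_repr x).symm
    rw [hx, map_sum]
    refine W.sum_mem fun g _ => ?_
    rw [diag_smul]
    exact W.smul_mem _ (Submodule.subset_span ⟨g, rfl⟩)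
  have hdense : Dense (W : Set (SemiLocal F E v)) := denseRange_diag.mono hsub
  rw [eq_top_iff]
  rintro x -
  show x ∈ (W : Set (SemiLocal F E v))
  rw [← hclosed.closure_eq, hdense.closure_eq]
  exact Set.mem_univ x

variable (F E v) in
/-- **The normal basis of `∏_{w ∣ v} E_w` over `F_v`**: `g ↦ diag (g α)` for the normal basis
`{g α}` of `E/F` (Mathlib `IsGalois.normalBasis`); i.e. `E ⊗_F F_v ≅ ∏_{w ∣ v} E_w`.
[cite: CasselsFrohlichANT1967, Ch. II §10] -/
def basis : Module.Basis (E ≃ₐ[F] E) (v.adicCompletion F) (SemiLocal F E v) :=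
  Module.Basis.mk linearIndependent_diag_normalBasis span_diag_normalBasis_eq_top.ge

/-- `basis g = diag (g α)`. [folklore] -/
theorem basis_apply (g : E ≃ₐ[F] E) : basis F E v g = diag F E v (IsGalois.normalBasis F E g) :=
  Module.Basis.mk_apply _ _ g

/-- **`basis` is a normal basis for the action of `Gal(E/F)`**: `σ • basis g = basis (σ g)`.
[folklore] -/
theorem smul_basis (σ g : E ≃ₐ[F] E) : σ • basis F E v g = basis F E v (σ * g) := by
  rw [basis_apply, basis_apply, smul_diag, IsGalois.normalBasis_apply g,
    IsGalois.normalBasis_apply (σ * g), AlgEquiv.mul_apply]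

/-- `∏_{w ∣ v} E_w` is finite-dimensional over `F_v`. [folklore] -/
instance finiteDimensional : FiniteDimensional (v.adicCompletion F) (SemiLocal F E v) :=
  (basis F E v).finiteDimensional_of_finite

/-- **The structure constants of `basis` are global**: they are the images in `F_v` of the
structure constants of the normal basis of `E/F`. [folklore] -/
theorem repr_basis_mul_basis (g h k : E ≃ₐ[F] E) :
    (basis F E v).repr (basis F E v g * basis F E v h) k =
      (((IsGalois.normalBasis F E).repr (IsGalois.normalBasis F E g * IsGalois.normalBasis F E h) k : F) :
        v.adicCompletion F) := by
  set nb := IsGalois.normalBasis F E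
  have : basis F E v g * basis F E v h =
      ∑ k, ((nb.repr (nb g * nb h) k : F) : v.adicCompletion F) • basis F E v k := by
    rw [basis_apply, basis_apply, ← map_mul]
    conv_lhs => rw [← nb.sum_repr (nb g * nb h)]
    rw [map_sum]
    exact Finset.sum_congr rfl fun k _ => by rw [diag_smul, basis_apply]
  rw [this, (basis F E v).repr_sum_self]

/-- `∑_g basis g = (Tr_{E/F} α)_{F_v}` with `α = normalBasis 1`, and `Tr α ≠ 0`. [folklore] -/
theorem sum_basis_eq :
    ∑ g : E ≃ₐ[F] E, basis F E v g =
      algebraMap (v.adicCompletion F) (SemiLocal F E v)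
        (Algebra.trace F E (IsGalois.normalBasis F E 1) : v.adicCompletion F) := by
  rw [← sum_smul_diag]
  exact Finset.sum_congr rfl fun g _ => by
    rw [basis_apply, smul_diag, IsGalois.normalBasis_apply g]

/-- The trace of a normal basis generator is non-zero (`∑_g g α` is a non-trivial linear
combination of a basis). [folklore] -/
theorem trace_normalBasis_one_ne_zero : Algebra.trace F E (IsGalois.normalBasis F E 1) ≠ 0 := by
  classical
  intro h
  have hsum : ∑ g : E ≃ₐ[F] E, IsGalois.normalBasis F E g = 0 := by
    have := trace_eq_sum_automorphisms (K := F) (IsGalois.normalBasis F E 1)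
    rw [h, map_zero] at this
    rw [this]
    exact Finset.sum_congr rfl fun g _ => IsGalois.normalBasis_apply g
  have hli := (IsGalois.normalBasis F E).linearIndependent
  rw [Fintype.linearIndependent_iff] at hli
  have := hli (fun _ => 1) (by simpa using hsum) 1
  exact one_ne_zero this

end Basis

/-! ### The unit group `∏_{w ∣ v} 𝒪_wˣ` and the congruence subgroup of a scaled normal basis -/

section Units

open NormalBasisCongr CyclicNormIndex

/-- The action of `Gal(E/F)` on the units `(∏_{w ∣ v} E_w)ˣ` (Mathlib
`Units.mulDistribMulActionRight`, registered for this concrete algebra as `ClassFieldCharacter.lean`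
does for the idele group; the same term as the scoped instance of `NormalBasisCongruence.lean`).
[folklore] -/
instance mulDistribMulActionUnits : MulDistribMulAction (E ≃ₐ[F] E) (SemiLocal F E v)ˣ :=
  Units.mulDistribMulActionRight

/-- `((σ • u : (∏ E_w)ˣ) : ∏ E_w) = σ • (u : ∏ E_w)` (definitional). [folklore] -/
theorem val_smul_units (σ : E ≃ₐ[F] E) (u : (SemiLocal F E v)ˣ) :
    ((σ • u : (SemiLocal F E v)ˣ) : SemiLocal F E v) = σ • (u : SemiLocal F E v) := rfl

variable (F E v) in
/-- **The semi-local unit group `∏_{w ∣ v} 𝒪_wˣ`**: the units of `∏ E_w` all of whose components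
have valuation `1` (Childress's `∏_{w ∣ v} 𝒰_w`). [cite: Childress2009, Ch. 4 §5 (PDF p. 92)] -/
def unitGroup : Subgroup (SemiLocal F E v)ˣ where
  carrier := {u | ∀ w, Valued.v ((u : SemiLocal F E v) w) = 1}
  one_mem' := fun w => by simp
  mul_mem' := fun {u u'} hu hu' w => by
    rw [Units.val_mul, Pi.mul_apply, map_mul, hu w, hu' w, mul_one]
  inv_mem' := fun {u} hu w => by
    have h1 : ((u⁻¹ : (SemiLocal F E v)ˣ) : SemiLocal F E v) w * (u : SemiLocal F E v) w = 1 := by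
      rw [← Pi.mul_apply, ← Units.val_mul, inv_mul_cancel, Units.val_one, Pi.one_apply]
    have := congrArg Valued.v h1
    rwa [map_mul, hu w, mul_one, map_one] at this

omit [NumberField F] in
/-- Membership in `∏ 𝒪_wˣ`. [folklore] -/
theorem mem_unitGroup_iff {u : (SemiLocal F E v)ˣ} :
    u ∈ unitGroup F E v ↔ ∀ w, Valued.v ((u : SemiLocal F E v) w) = 1 := Iff.rfl

/-- `∏ 𝒪_wˣ` is `Gal(E/F)`-stable (`σ` preserves valuations). [cite: CasselsFrohlichANT1967, Ch. VII §1.1] -/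
theorem isStable_unitGroup : Herbrand.IsStable (E ≃ₐ[F] E) (unitGroup F E v) := by
  intro σ u hu w
  show Valued.v ((σ • (u : SemiLocal F E v)) w) = 1
  rw [smul_apply, valued_galAdicCompletionMap]
  exact hu _

omit [NumberField F] in
/-- A unit whose components and whose inverse's components are integral lies in `∏ 𝒪_wˣ`.
[folklore] -/
theorem mem_unitGroup_of_valued_le_one {u : (SemiLocal F E v)ˣ}
    (h₁ : ∀ w, Valued.v ((u : SemiLocal F E v) w) ≤ 1)
    (h₂ : ∀ w, Valued.v (((u⁻¹ : (SemiLocal F E v)ˣ) : SemiLocal F E v) w) ≤ 1) :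
    u ∈ unitGroup F E v := by
  intro w
  have hprod : Valued.v ((u : SemiLocal F E v) w) *
      Valued.v (((u⁻¹ : (SemiLocal F E v)ˣ) : SemiLocal F E v) w) = 1 := by
    rw [← map_mul, ← Pi.mul_apply, ← Units.val_mul, mul_inv_cancel, Units.val_one, Pi.one_apply,
      map_one]
  refine le_antisymm (h₁ w) ?_
  calc (1 : WithZero (Multiplicative ℤ))
      = Valued.v ((u : SemiLocal F E v) w) *
          Valued.v (((u⁻¹ : (SemiLocal F E v)ˣ) : SemiLocal F E v) w) := hprod.symm
    _ ≤ Valued.v ((u : SemiLocal F E v) w) * 1 := mul_le_mul' le_rfl (h₂ w)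
    _ = Valued.v ((u : SemiLocal F E v) w) := mul_one _

/-- Integrality of scalars: `‖c‖ ≤ 1` in `F_v` gives `v_w(c) ≤ 1` in `E_w`. [folklore] -/
theorem valued_algebraMap_le_one {c : v.adicCompletion F} (hc : ‖c‖ ≤ 1) (w : Place F E v) :
    Valued.v (algebraMap (v.adicCompletion F) ((w : HeightOneSpectrum (𝓞 E)).adicCompletion E) c) ≤ 1 := by
  rw [Valued.toNormedField.norm_le_one_iff] at hc
  exact (HeightOneSpectrum.mem_adicCompletionIntegers _ _ _).mp
    (adicCompletionOfLiesOver_mem_adicCompletionIntegers F E v _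
      ((HeightOneSpectrum.mem_adicCompletionIntegers _ _ _).mpr hc))

variable [IsGalois F E]

variable (E) in
/-- The scaled normal basis `g ↦ π^t · basis g` (`π ≠ 0`). [cite: NeukirchANT1999, Ch. V §1 Thm. (1.1) (proof)] -/
def scaledBasis {π : v.adicCompletion F} (hπ0 : π ≠ 0) (t : ℕ) :
    Module.Basis (E ≃ₐ[F] E) (v.adicCompletion F) (SemiLocal F E v) :=
  (basis F E v).unitsSMul fun _ => Units.mk0 π hπ0 ^ t

/-- `scaledBasis g = π^t • basis g`. [folklore] -/
theorem scaledBasis_apply {π : v.adicCompletion F} (hπ0 : π ≠ 0) (t : ℕ) (g : E ≃ₐ[F] E) :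
    scaledBasis E hπ0 t g = π ^ t • basis F E v g := by
  rw [scaledBasis, Module.Basis.unitsSMul_apply, Units.smul_def, Units.val_pow_eq_pow_val,
    Units.val_mk0]

/-- The scaled basis is still a normal basis. [folklore] -/
theorem smul_scaledBasis {π : v.adicCompletion F} (hπ0 : π ≠ 0) (t : ℕ) (σ g : E ≃ₐ[F] E) :
    σ • scaledBasis E hπ0 t g = scaledBasis E hπ0 t (σ * g) := by
  rw [scaledBasis_apply, scaledBasis_apply, smul_comm, smul_basis]

/-- The structure constants of the scaled basis are `π^t` times the global ones. [folklore] -/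
theorem repr_scaledBasis_mul (π : v.adicCompletion F) (hπ0 : π ≠ 0) (t : ℕ) (g h k : E ≃ₐ[F] E) :
    (scaledBasis E hπ0 t).repr (scaledBasis E hπ0 t g * scaledBasis E hπ0 t h) k =
      π ^ t * (basis F E v).repr (basis F E v g * basis F E v h) k := by
  rw [scaledBasis, Module.Basis.repr_unitsSMul, Module.Basis.unitsSMul_apply,
    Module.Basis.unitsSMul_apply]
  simp only [Units.smul_def, Units.val_pow_eq_pow_val, Units.val_mk0, smul_mul_smul_comm, map_smul,
    Finsupp.smul_apply, smul_eq_mul, Units.val_inv_eq_inv_val]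
  have hπt : π ^ t ≠ 0 := pow_ne_zero t hπ0
  field_simp

/-- **Choice of the scaling exponent**: for `0 < ‖π‖ < 1` there is `t` such that the scaled normal
basis has structure constants of norm `≤ ‖π‖` and integral components at every `w ∣ v`.
[cite: NeukirchANT1999, Ch. V §1 Thm. (1.1) (proof)] -/
theorem exists_scaling (π : v.adicCompletion F) (hπ0 : π ≠ 0) (hπ : ‖π‖ < 1) :
    ∃ t : ℕ, (∀ g h k : E ≃ₐ[F] E,
        ‖(scaledBasis E hπ0 t).repr (scaledBasis E hπ0 t g * scaledBasis E hπ0 t h) k‖ ≤ ‖π‖) ∧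
      ∀ (g : E ≃ₐ[F] E) (w : Place F E v), Valued.v (scaledBasis E hπ0 t g w) ≤ 1 := by
  have hπpos : 0 < ‖π‖ := norm_pos_iff.mpr hπ0
  -- structure constants
  have h1 : ∀ g h k : E ≃ₐ[F] E, ∃ t₀ : ℕ, ∀ t, t₀ ≤ t →
      ‖(scaledBasis E hπ0 t).repr (scaledBasis E hπ0 t g * scaledBasis E hπ0 t h) k‖ ≤ ‖π‖ := by
    intro g h k
    set C := ‖(basis F E v).repr (basis F E v g * basis F E v h) k‖ with hC
    obtain ⟨n, hn⟩ := exists_pow_lt_of_lt_one (show 0 < ‖π‖ / (C + 1) by positivity) hπ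
    refine ⟨n + 1, fun t ht => ?_⟩
    rw [repr_scaledBasis_mul, norm_mul, norm_pow, ← hC]
    have hle : ‖π‖ ^ t ≤ ‖π‖ ^ (n + 1) := pow_le_pow_of_le_one hπpos.le hπ.le ht
    calc ‖π‖ ^ t * C ≤ ‖π‖ ^ (n + 1) * C := mul_le_mul_of_nonneg_right hle (norm_nonneg _)
      _ = ‖π‖ * (‖π‖ ^ n * C) := by ring
      _ ≤ ‖π‖ * 1 := by
          refine mul_le_mul_of_nonneg_left ?_ hπpos.le
          have hC0 : 0 ≤ C := norm_nonneg _
          have : ‖π‖ ^ n * (C + 1) < ‖π‖ := (lt_div_iff₀ (by positivity)).mp hn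
          nlinarith [hπ.le]
      _ = ‖π‖ := mul_one _
  -- integrality
  have h2 : ∀ (g : E ≃ₐ[F] E) (w : Place F E v), ∃ t₀ : ℕ, ∀ t, t₀ ≤ t →
      Valued.v (scaledBasis E hπ0 t g w) ≤ 1 := by
    intro g w
    have hπw : ‖algebraMap (v.adicCompletion F) ((w : HeightOneSpectrum (𝓞 E)).adicCompletion E) π‖ < 1 := by
      rw [Valued.toNormedField.norm_lt_one_iff, algebraMap_place_eq, valued_adicCompletionOfLiesOver]
      rw [Valued.toNormedField.norm_lt_one_iff] at hπ
      exact pow_lt_one' hπ (Ideal.IsDedekindDomain.ramificationIdx'_ne_zero_of_liesOver _ v.ne_bot)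
    set C := ‖basis F E v g w‖ with hC
    obtain ⟨n, hn⟩ := exists_pow_lt_of_lt_one (show 0 < 1 / (C + 1) by positivity) hπw
    refine ⟨n, fun t ht => ?_⟩
    rw [← Valued.toNormedField.norm_le_one_iff, scaledBasis_apply, Pi.smul_apply, Algebra.smul_def,
      norm_mul, map_pow, norm_pow, ← hC]
    have h0 : 0 ≤ ‖algebraMap (v.adicCompletion F) ((w : HeightOneSpectrum (𝓞 E)).adicCompletion E) π‖ :=
      norm_nonneg _
    have hle := pow_le_pow_of_le_one h0 hπw.le ht
    have hC0 : 0 ≤ C := norm_nonneg _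
    have : ‖algebraMap (v.adicCompletion F) ((w : HeightOneSpectrum (𝓞 E)).adicCompletion E) π‖ ^ n *
        (C + 1) < 1 := (lt_div_iff₀ (by positivity)).mp hn
    nlinarith [pow_nonneg h0 t, pow_nonneg h0 n]
  choose t₁ ht₁ using h1
  choose t₂ ht₂ using h2
  classical
  let T : ℕ := (Finset.univ.sup fun p : (E ≃ₐ[F] E) × (E ≃ₐ[F] E) × (E ≃ₐ[F] E) => t₁ p.1 p.2.1 p.2.2) ⊔
    Finset.univ.sup fun p : (E ≃ₐ[F] E) × Place F E v => t₂ p.1 p.2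
  refine ⟨T, fun g h k => ht₁ g h k T ?_, fun g w => ht₂ g w T ?_⟩
  · exact le_sup_of_le_left (Finset.le_sup (f := fun p : (E ≃ₐ[F] E) × (E ≃ₐ[F] E) × (E ≃ₐ[F] E) =>
      t₁ p.1 p.2.1 p.2.2) (Finset.mem_univ (g, h, k)))
  · exact le_sup_of_le_right (Finset.le_sup (f := fun p : (E ≃ₐ[F] E) × Place F E v => t₂ p.1 p.2)
      (Finset.mem_univ (g, w)))

/-- Elements of the lattice `M_0` of an integral scaled basis have integral components. [folklore] -/
theorem valued_apply_le_one_of_mem_latt {π : v.adicCompletion F} (hπ0 : π ≠ 0) {t : ℕ}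
    (hint : ∀ (g : E ≃ₐ[F] E) (w : Place F E v), Valued.v (scaledBasis E hπ0 t g w) ≤ 1) {m : SemiLocal F E v}
    (hm : m ∈ latt (scaledBasis E hπ0 t) π 0) (w : Place F E v) : Valued.v (m w) ≤ 1 := by
  have hrepr : m = ∑ g, (scaledBasis E hπ0 t).repr m g • scaledBasis E hπ0 t g :=
    ((scaledBasis E hπ0 t).sum_repr m).symm
  rw [hrepr, Finset.sum_apply]
  refine Valuation.map_sum_le _ fun g _ => ?_
  rw [Pi.smul_apply, Algebra.smul_def, map_mul]
  have hc : ‖(scaledBasis E hπ0 t).repr m g‖ ≤ 1 := by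
    have := hm g
    rwa [pow_zero] at this
  exact mul_le_one' (valued_algebraMap_le_one hc w) (hint g w)

/-- **The congruence subgroup `V_0` of an integral scaled basis lies in `∏ 𝒪_wˣ`.**
[cite: NeukirchANT1999, Ch. V §1 Thm. (1.1) (proof)] -/
theorem congrUnits_le_unitGroup {π : v.adicCompletion F} (hπ0 : π ≠ 0) (hπ : ‖π‖ < 1) {t : ℕ}
    (hmul : ∀ g h k : E ≃ₐ[F] E,
      ‖(scaledBasis E hπ0 t).repr (scaledBasis E hπ0 t g * scaledBasis E hπ0 t h) k‖ ≤ ‖π‖)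
    (hint : ∀ (g : E ≃ₐ[F] E) (w : Place F E v), Valued.v (scaledBasis E hπ0 t g w) ≤ 1) :
    congrUnits (scaledBasis E hπ0 t) π hmul hπ 0 ≤ unitGroup F E v := by
  intro u hu
  have key : ∀ u : (SemiLocal F E v)ˣ, u ∈ congrUnits (scaledBasis E hπ0 t) π hmul hπ 0 →
      ∀ w, Valued.v ((u : SemiLocal F E v) w) ≤ 1 := by
    intro u hu w
    have hm : (u : SemiLocal F E v) - 1 ∈ latt (scaledBasis E hπ0 t) π 0 := hu
    have : (u : SemiLocal F E v) w = 1 + ((u : SemiLocal F E v) - 1) w := by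
      rw [Pi.sub_apply, Pi.one_apply]; ring
    rw [this]
    refine (Valuation.map_add _ _ _).trans (max_le ?_ (valued_apply_le_one_of_mem_latt hπ0 hint hm w))
    rw [map_one]
  exact mem_unitGroup_of_valued_le_one (key u hu) (key u⁻¹ (Subgroup.inv_mem _ hu))

/-- **The congruence subgroup has finite index in `∏ 𝒪_wˣ`**: it is open (the coordinates of the
basis are continuous on the finite-dimensional `F_v`-space `∏ E_w`) and `∏ 𝒪_wˣ` is compact.
[cite: Childress2009, Ch. 4 §5 Lemma 5.3 (proof, PDF p. 93)] -/
theorem relIndex_congrUnits_ne_zero {π : v.adicCompletion F} (hπ0 : π ≠ 0) (hπ : ‖π‖ < 1) {t : ℕ}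
    (hmul : ∀ g h k : E ≃ₐ[F] E,
      ‖(scaledBasis E hπ0 t).repr (scaledBasis E hπ0 t g * scaledBasis E hπ0 t h) k‖ ≤ ‖π‖) :
    (congrUnits (scaledBasis E hπ0 t) π hmul hπ 0).relIndex (unitGroup F E v) ≠ 0 := by
  classical
  letI : NontriviallyNormedField (v.adicCompletion F) :=
    Valued.toNontriviallyNormedField (v.adicCompletion F) (WithZero (Multiplicative ℤ))
  set b := scaledBasis E hπ0 t with hb
  set V := congrUnits b π hmul hπ 0 with hV
  -- the compact set `∏ 𝒪_wˣ ⊆ ∏ E_w`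
  set Uset : Set (SemiLocal F E v) := {x | ∀ w, Valued.v (x w) = 1} with hUset
  have hUcpt : IsCompact Uset := by
    have hpi : Uset = Set.pi Set.univ fun w : Place F E v =>
        {y : (w : HeightOneSpectrum (𝓞 E)).adicCompletion E | Valued.v y = 1} := by
      ext x; simp [hUset]
    rw [hpi]
    refine isCompact_univ_pi fun w => ?_
    have hO : IsCompact ((((w : HeightOneSpectrum (𝓞 E)).adicCompletionIntegers E) :
        Set ((w : HeightOneSpectrum (𝓞 E)).adicCompletion E))) :=
      isCompact_iff_compactSpace.mpr (compactSpace_adicCompletionIntegers' E _)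
    refine hO.of_isClosed_subset ?_ fun y hy => ?_
    · have : {y : (w : HeightOneSpectrum (𝓞 E)).adicCompletion E | Valued.v y = 1} =
          (fun y => ‖y‖) ⁻¹' {1} := by
        ext y
        simp only [Set.mem_setOf_eq, Set.mem_preimage, Set.mem_singleton_iff]
        rw [le_antisymm_iff, le_antisymm_iff, Valued.toNormedField.norm_le_one_iff,
          Valued.toNormedField.one_le_norm_iff]
      rw [this]
      exact (isClosed_singleton).preimage continuous_norm
    · exact (HeightOneSpectrum.mem_adicCompletionIntegers _ _ _).mpr (le_of_eq hy)
  -- the open set `V_0 ⊆ ∏ E_w`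
  set Vset : Set (SemiLocal F E v) := CyclicNormIndex.congr b π 0 with hVset
  have hVopen : IsOpen Vset := by
    have hlatt : IsOpen ((latt b π 0 : AddSubgroup (SemiLocal F E v)) : Set (SemiLocal F E v)) := by
      have : ((latt b π 0 : AddSubgroup (SemiLocal F E v)) : Set (SemiLocal F E v)) =
          ⋂ g, (fun m => b.repr m g) ⁻¹' Metric.closedBall 0 1 := by
        ext m
        simp [mem_latt_iff]
      rw [this]
      refine isOpen_iInter_of_finite fun g => ?_
      have hc : Continuous fun m : SemiLocal F E v => b.repr m g :=
        (b.coord g).continuous_of_finiteDimensional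
      exact (IsUltrametricDist.isOpen_closedBall 0 one_ne_zero).preimage hc
    have : Vset = (fun x : SemiLocal F E v => x - 1) ⁻¹'
        ((latt b π 0 : AddSubgroup (SemiLocal F E v)) : Set (SemiLocal F E v)) := by
      ext x; rfl
    rw [this]
    exact hlatt.preimage (continuous_sub_right 1)
  -- units of `Uset`
  have hUunit : ∀ x ∈ Uset, IsUnit x := fun x hx =>
    Pi.isUnit_iff.mpr fun w => isUnit_iff_ne_zero.mpr fun h0 => by
      have := hx w; rw [h0, map_zero] at this; exact zero_ne_one this
  -- the cover by translates of `Vset`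
  have hcover : Uset ⊆ ⋃ x : Uset,
      (fun y => (((hUunit x.1 x.2).unit⁻¹ : (SemiLocal F E v)ˣ) : SemiLocal F E v) * y) ⁻¹' Vset := by
    intro x hx
    refine Set.mem_iUnion.mpr ⟨⟨x, hx⟩, ?_⟩
    show (((hUunit x hx).unit⁻¹ : (SemiLocal F E v)ˣ) : SemiLocal F E v) * x ∈ CyclicNormIndex.congr b π 0
    rw [IsUnit.val_inv_mul]
    exact one_mem_congr 0
  have hopen : ∀ x : Uset, IsOpen
      ((fun y => (((hUunit x.1 x.2).unit⁻¹ : (SemiLocal F E v)ˣ) : SemiLocal F E v) * y) ⁻¹' Vset) :=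
    fun x => hVopen.preimage (continuous_const.mul continuous_id)
  obtain ⟨T, hT⟩ := hUcpt.elim_finite_subcover _ hopen hcover
  -- the finitely many classes
  have hUmem : ∀ x : Uset, (hUunit x.1 x.2).unit ∈ unitGroup F E v := fun x w => by
    rw [IsUnit.unit_spec]; exact x.2 w
  let f : T → unitGroup F E v ⧸ V.subgroupOf (unitGroup F E v) :=
    fun x => QuotientGroup.mk ⟨(hUunit x.1.1 x.1.2).unit, hUmem x.1⟩
  have hf : Function.Surjective f := by
    rintro ⟨u, hu⟩
    have huU : (u : SemiLocal F E v) ∈ Uset := hu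
    obtain ⟨x, hxT, hx⟩ : ∃ x ∈ T, (u : SemiLocal F E v) ∈
        (fun y => (((hUunit x.1 x.2).unit⁻¹ : (SemiLocal F E v)ˣ) : SemiLocal F E v) * y) ⁻¹' Vset := by
      simpa only [Set.mem_iUnion, exists_prop] using hT huU
    refine ⟨⟨x, hxT⟩, ?_⟩
    apply Quotient.sound'
    -- `unit(x)⁻¹ * u ∈ V`
    show QuotientGroup.leftRel (V.subgroupOf (unitGroup F E v)) ⟨(hUunit x.1 x.2).unit, hUmem x⟩ ⟨u, hu⟩
    rw [QuotientGroup.leftRel_apply, Subgroup.mem_subgroupOf]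
    exact hx
  haveI : Finite (unitGroup F E v ⧸ V.subgroupOf (unitGroup F E v)) := Finite.of_surjective f hf
  exact Subgroup.index_ne_zero_of_finite

/-! ### The Herbrand quotient of `∏_{w ∣ v} 𝒪_wˣ` and its norm group -/

/-- A uniformizer of `F` at `v`, seen in `F_v`: an element `π` with `π ≠ 0` and `‖π‖ < 1`.
[folklore] -/
theorem exists_norm_lt_one : ∃ π : v.adicCompletion F, π ≠ 0 ∧ ‖π‖ < 1 := by
  obtain ⟨π, hπ⟩ := v.valuation_exists_uniformizer F
  refine ⟨(π : v.adicCompletion F), ?_, ?_⟩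
  · intro h0
    have := HeightOneSpectrum.adicCompletion.valued_coe (K := F) (v := v) π
    rw [h0, map_zero, hπ] at this
    exact WithZero.coe_ne_zero this.symm
  · rw [Valued.toNormedField.norm_lt_one_iff, HeightOneSpectrum.adicCompletion.valued_coe, hπ,
      ← WithZero.exp_zero, WithZero.exp_lt_exp]
    norm_num

/-- **`Q_G(∏_{w ∣ v} 𝒰_w) = 1` (Childress, Prop. 5.7 (i) with Shapiro's lemma Prop. 4.5), index
form.**  For a cyclic Galois extension `E/F` with `Gal(E/F) = ⟨σ⟩` and a finite place `v` of `F`,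
`#Ĥ⁰(G, ∏_{w ∣ v} 𝒪_wˣ) = #Ĥ⁻¹(G, ∏_{w ∣ v} 𝒪_wˣ)`, both finite and non-zero: the congruence
subgroup `V` of a scaled normal basis is a `G`-stable subgroup of `∏ 𝒪_wˣ` of finite index with
`Ĥ⁰(G, V) = Ĥ⁻¹(G, V) = 1` (`NormalBasisCongruence.lean`), and a subgroup of finite index has the
same Herbrand quotient (`Herbrand.h0_mul_h1_eq_of_relIndex_ne_zero`, Childress Cor. 4.4).
[cite: Childress2009, Ch. 4 §5 Prop. 5.7 (i) (PDF p. 98)] -/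
theorem h0_unitGroup_eq_h1 {σ : E ≃ₐ[F] E} (hσ : ∀ τ : E ≃ₐ[F] E, τ ∈ Subgroup.zpowers σ) :
    Herbrand.h0 σ (unitGroup F E v) ⊥ = Herbrand.h1 σ (unitGroup F E v) ⊥ ∧
      Herbrand.h0 σ (unitGroup F E v) ⊥ ≠ 0 := by
  obtain ⟨π, hπ0, hπ⟩ := exists_norm_lt_one (F := F) (v := v)
  obtain ⟨t, hmul, hint⟩ := exists_scaling (E := E) π hπ0 hπ
  set V := congrUnits (scaledBasis E hπ0 t) π hmul hπ 0 with hV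
  have hb : ∀ g h : E ≃ₐ[F] E, g • scaledBasis E hπ0 t h = scaledBasis E hπ0 t (g * h) :=
    smul_scaledBasis hπ0 t
  have hVst : Herbrand.IsStable (E ≃ₐ[F] E) V := isStable_congrUnits hb hmul hπ 0
  have hUst : Herbrand.IsStable (E ≃ₐ[F] E) (unitGroup F E v) := isStable_unitGroup
  have hVU : V ≤ unitGroup F E v := congrUnits_le_unitGroup hπ0 hπ hmul hint
  have hfin : V.relIndex (unitGroup F E v) ≠ 0 := relIndex_congrUnits_ne_zero hπ0 hπ hmul
  have hV0 : Herbrand.h0 σ V ⊥ = 1 := h0_congrUnits_eq_one hb hσ hmul hπ 0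
  have hV1 : Herbrand.h1 σ V ⊥ = 1 := h1_congrUnits_eq_one hb hσ hmul hπ 0
  have hmulid := Herbrand.h0_mul_h1_eq_of_relIndex_ne_zero (σ := σ) hUst hVst Herbrand.IsStable.bot
    bot_le hVU hfin
  rw [hV0, hV1, mul_one, one_mul] at hmulid
  refine ⟨hmulid, ?_⟩
  rw [Herbrand.h0_ne_zero_iff_of_relIndex_ne_zero (σ := σ) hUst hVst Herbrand.IsStable.bot bot_le hVU
    hfin, hV0]
  exact one_ne_zero

/-- **The local norm group `N_G(∏_{w ∣ v} 𝒪_wˣ)` contains a neighbourhood of `1` in `F_v`**: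
there is `δ > 0` such that every `x ∈ F_v` with `‖x - 1‖ ≤ δ` is, as an element of `∏ E_w`, the
norm `∏_σ σ • y` of a unit `y ∈ ∏ 𝒪_wˣ` (indeed of the congruence subgroup of a scaled normal
basis: its fixed elements `1 + c · ∑_g b_g = 1 + c π^t Tr(α)` are norms; Childress's
"`N_{K_w/F_v} 𝒰_w` is open", proof of Prop. 5.6 (i)). [cite: Childress2009, Ch. 4 §5 Prop. 5.6 (i) (proof, PDF pp. 95–96)] -/
theorem exists_norm_eq_algebraMap_of_norm_sub_one_le :
    ∃ δ : ℝ, 0 < δ ∧ ∀ x : v.adicCompletion F, ‖x - 1‖ ≤ δ →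
      ∃ y ∈ unitGroup F E v, ((Herbrand.norm (E ≃ₐ[F] E) y : (SemiLocal F E v)ˣ) : SemiLocal F E v) =
        algebraMap (v.adicCompletion F) (SemiLocal F E v) x := by
  obtain ⟨π, hπ0, hπ⟩ := exists_norm_lt_one (F := F) (v := v)
  obtain ⟨t, hmul, hint⟩ := exists_scaling (E := E) π hπ0 hπ
  have hb : ∀ g h : E ≃ₐ[F] E, g • scaledBasis E hπ0 t h = scaledBasis E hπ0 t (g * h) :=
    smul_scaledBasis hπ0 t
  have hVU := congrUnits_le_unitGroup (E := E) hπ0 hπ hmul hint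
  -- `∑_g b_g = (π^t Tr α)_{F_v}`
  set d : v.adicCompletion F := π ^ t * (Algebra.trace F E (IsGalois.normalBasis F E 1) : v.adicCompletion F)
    with hd
  have hsum : ∑ g : E ≃ₐ[F] E, scaledBasis E hπ0 t g =
      algebraMap (v.adicCompletion F) (SemiLocal F E v) d := by
    simp_rw [scaledBasis_apply]
    rw [← Finset.smul_sum, sum_basis_eq, Algebra.smul_def, ← map_mul]
  have hd0 : d ≠ 0 := by
    refine mul_ne_zero (pow_ne_zero t hπ0) ?_
    intro h
    apply trace_normalBasis_one_ne_zero (F := F) (E := E)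
    have hinj : Function.Injective (algebraMap F (v.adicCompletion F)) := (algebraMap F _).injective
    exact hinj (by rw [map_zero]; exact h)
  refine ⟨‖d‖, norm_pos_iff.mpr hd0, fun x hx => ?_⟩
  -- `x = 1 + c d` with `‖c‖ ≤ 1`
  set c : v.adicCompletion F := (x - 1) / d with hc
  have hcle : ‖c‖ ≤ ‖π‖ ^ 0 := by
    rw [pow_zero, hc, norm_div, div_le_one (norm_pos_iff.mpr hd0)]
    exact hx
  obtain ⟨y, hy, hNy⟩ := exists_norm_eq_one_add_smul_sum hb hmul hπ hcle
  refine ⟨y, hVU hy, ?_⟩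
  rw [hNy, hsum, Algebra.smul_def, ← map_mul, ← map_one (algebraMap (v.adicCompletion F) (SemiLocal F E v)),
    ← map_add]
  congr 1
  rw [hc, div_mul_cancel₀ _ hd0]
  ring

end Units

end SemiLocal

end Literature.NumberTheory.GaloisRepresentations
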